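import Summits.AnomalousDissipation.AnomalousDissipation.Theorems.QuasiStaticSolenoidalCellTensorQ.Negative.Exchange
import HarnessLib

/-!
# Negative side of K2Q `QuasiStaticSolenoidalCellTensorQ` (stmt-AnomalousDissipation-19072): drift of the principal mode and
# the frozen-polarisation comparison (helper, `--supports stmt-AnomalousDissipation-19072`)

Summits-side helper file (everything proved; no definitions, no named facts).  The Taylor drain density `ψ` of
`exchange_le_cell` carries the polarisation factors `‖Π_{±ℓ∓K_j} α_N(t)(±ℓ)‖²` of the CURRENT principal vector; the
isotropy of the word acts on a FIXED vector summed over a whole period.  This file controls the difference: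
* `principal_drift` — along a window on which the rest energy is at most `R_max`, the heat-renormalised principal vector
  moves little: `‖e^{κ4π²|ℓ|²(t−t₀)}α_N(t)(ℓ) − α_N(t₀)(ℓ)‖ ≤ e^{κ4π²|ℓ|²(t₁−t₀)}·c_F·√R_max·(t − t₀)`,
  `c_F = Σ_j (2π|ê_j·ℓ|/n)(‖a_j‖ + ‖a'_j‖)` (the exchange feeds `ℓ` only from rest modes; mean value inequality);
* `norm_sq_leraySym_le_of_drift` — `‖Π_m v‖² ≤ (1+ε)‖Π_m v₀‖² + (1 + 1/ε)‖v − v₀‖²` (Leray symbol is a linear contraction).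
This is NOT a proof of anomalous dissipation, and by itself not of `¬ K2Q`.
-/

set_option linter.dupNamespace false

noncomputable section

namespace Summit.AnomalousDissipation.AnomalousDissipation.Theorems.QuasiStaticSolenoidalCellTensorQ.Negative

open Set MeasureTheory Filter Topology Function
open scoped InnerProductSpace ComplexConjugate BigOperators
open Literature.Analysis Literature.Analysis.FunctionSpaces Literature.Analysis.FunctionSpaces.Torus
open Literature.Analysis.FluidPDE Literature.Analysis.FluidPDE.LatticeShear
open Summit.AnomalousDissipation.AnomalousDissipation.Theorems.SolenoidalFractalHomogenisation.PermissibleCarrier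
open Summit.AnomalousDissipation.AnomalousDissipation.Theorems.SolenoidalFractalHomogenisation.RealisedQuasiStaticCellLaw

variable {k₀ : ℕ}

/-! ## §1 Frozen polarisation: the Leray symbol of a drifted vector -/

/-- **`‖Π_m v‖² ≤ (1+ε)‖Π_m v₀‖² + (1 + 1/ε)‖v − v₀‖²`** for `ε > 0` (`Π_m` linear, `‖Π_m‖ ≤ 1`). -/
theorem norm_sq_leraySym_le_of_drift (m : Fin 3 → ℤ) (v v₀ : EuclideanSpace ℂ (Fin 3)) {ε : ℝ} (hε : 0 < ε) :
    ‖Torus.leraySym m v‖ ^ 2 ≤ (1 + ε) * ‖Torus.leraySym m v₀‖ ^ 2 + (1 + 1 / ε) * ‖v - v₀‖ ^ 2 := by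
  have h1 : ‖Torus.leraySym m v‖ ≤ ‖Torus.leraySym m v₀‖ + ‖v - v₀‖ := by
    have e : Torus.leraySym m v = Torus.leraySym m v₀ + Torus.leraySym m (v - v₀) := by
      rw [Torus.leraySym_sub]; abel
    rw [e]
    exact (norm_add_le _ _).trans (add_le_add le_rfl (Torus.norm_leraySym_le m _))
  set a := ‖Torus.leraySym m v₀‖ with ha
  set b := ‖v - v₀‖ with hb
  have ha0 : 0 ≤ a := norm_nonneg _
  have hb0 : 0 ≤ b := norm_nonneg _
  have h2 : ‖Torus.leraySym m v‖ ^ 2 ≤ (a + b) ^ 2 := pow_le_pow_left₀ (norm_nonneg _) h1 2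
  -- `(a+b)² ≤ (1+ε)a² + (1+1/ε)b²` since `2ab ≤ εa² + b²/ε`
  have h3 : 2 * a * b ≤ ε * a ^ 2 + (1 / ε) * b ^ 2 := by
    have h := sq_nonneg (ε * a - b)
    have e : (ε * a - b) ^ 2 = ε * (ε * a ^ 2 + (1 / ε) * b ^ 2 - 2 * a * b) := by field_simp; ring
    rw [e] at h
    have := (mul_nonneg_iff_of_pos_left hε).1 h
    linarith
  nlinarith

/-! ## §2 Drift of the heat-renormalised principal vector -/

set_option maxHeartbeats 800000 in
/-- **Drift of the principal vector.** On a window `[t₀, t₁] ⊆ [0, T]` along which the rest energy of the truncation is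
at most `R_max`, for `ℓ ≠ 0` with `2|ℓ| < n` and the four fed modes of every slot resolved:
`‖e^{κ4π²|ℓ|²(t−t₀)} α_N(t)(ℓ) − α_N(t₀)(ℓ)‖ ≤ e^{κ4π²|ℓ|²(t₁−t₀)}·c_F·√R_max·(t − t₀)` for `t ∈ [t₀, t₁]`,
`c_F = Σ_j (1/n)(2π|ê_j·ℓ|)(‖a_j‖ + ‖a'_j‖)`. -/
theorem principal_drift (W : LatticeWord k₀) {n : ℕ} (hn : 0 < n) {κ : ℝ} (hκ : 0 < κ)
    (ℓ : Fin 3 → ℤ) (hℓ : ℓ ≠ 0) (hℓn : 2 * ‖latticeVec ℓ‖ < n) {w₀ : UnitAddTorus (Fin 3) → EuclideanSpace ℝ (Fin 3)}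
    (hw₀ : FunctionSpaces.Torus.MemSobolev 1 (FunctionSpaces.EuclideanSpace.complexify ∘ w₀))
    (hdiv : FunctionSpaces.Torus.IsWeaklyDivFree w₀) (hmean : FunctionSpaces.Torus.HasZeroMean w₀)
    (hsupp : ∀ k : Fin 3 → ℤ, ¬ ((∃ z : Fin 3 → ℤ, k = ℓ + (n:ℤ) • z) ∨ (∃ z : Fin 3 → ℤ, k = -ℓ + (n:ℤ) • z)) →
      UnitAddTorus.mFourierCoeff (FunctionSpaces.EuclideanSpace.complexify ∘ w₀) k = 0)
    {N : ℕ} (hBN : (Finset.univ.biUnion fun j : Fin k₀ =>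
        ({(fun i => (W.phase j).m i * n), -(fun i => (W.phase j).m i * n)} : Finset (Fin 3 → ℤ))) ⊆ freqBall N)
    (hℓN : ℓ ∈ freqBall N)
    (hball : ∀ j : Fin k₀, ∀ k ∈ ({ℓ, -ℓ} : Finset (Fin 3 → ℤ)),
      k - (fun i => (W.phase j).m i * (n : ℤ)) ∈ freqBall N ∧ k + (fun i => (W.phase j).m i * (n : ℤ)) ∈ freqBall N)
    {T t₀ t₁ : ℝ} (ht₀ : 0 ≤ t₀) (ht₀₁ : t₀ ≤ t₁) (ht₁ : t₁ ≤ T) {Rmax : ℝ}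
    (hR : ∀ t ∈ Icc t₀ t₁, ∑ k ∈ freqBall N \ {ℓ, -ℓ},
      ‖(pvSetup_cell W hn hκ.le ℓ hw₀ hdiv hmean hsupp).galerkinCoeffAt N t k‖ ^ 2 ≤ Rmax) :
    ∀ t ∈ Icc t₀ t₁,
      ‖((Real.exp (κ * (4 * Real.pi ^ 2 * freqNormSq ℓ) * (t - t₀)) : ℝ) : ℂ) •
            (pvSetup_cell W hn hκ.le ℓ hw₀ hdiv hmean hsupp).galerkinCoeffAt N t ℓ -
          (pvSetup_cell W hn hκ.le ℓ hw₀ hdiv hmean hsupp).galerkinCoeffAt N t₀ ℓ‖ ≤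
        Real.exp (κ * (4 * Real.pi ^ 2 * freqNormSq ℓ) * (t₁ - t₀)) *
          ((∑ j : Fin k₀, (1 / (n : ℝ)) * (2 * Real.pi * |∑ i, (W.phase j).e i * (ℓ i : ℝ)|) *
              (‖Complex.exp ((W.phase j).φ * Complex.I) *
                  (1 / (2 * ((2 * Real.pi * ‖latticeVec (W.phase j).m‖ : ℝ) : ℂ) * Complex.I))‖ +
                ‖starRingEnd ℂ (Complex.exp ((W.phase j).φ * Complex.I)) *
                  (-(1 / (2 * ((2 * Real.pi * ‖latticeVec (W.phase j).m‖ : ℝ) : ℂ) * Complex.I)))‖)) *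
            Real.sqrt Rmax) * (t - t₀) := by
  classical
  set hPV := pvSetup_cell W hn hκ.le ℓ hw₀ hdiv hmean hsupp with hPVdef
  set L : ℝ := κ * (4 * Real.pi ^ 2 * freqNormSq ℓ) with hL
  have hL0 : 0 ≤ L := by rw [hL]; exact mul_nonneg hκ.le (mul_nonneg (by positivity) (freqNormSq_nonneg _))
  -- abbreviations
  set A : Fin k₀ → ℂ := fun j => Complex.exp ((W.phase j).φ * Complex.I) *
      (1 / (2 * ((2 * Real.pi * ‖latticeVec (W.phase j).m‖ : ℝ) : ℂ) * Complex.I)) with hA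
  set A' : Fin k₀ → ℂ := fun j => starRingEnd ℂ (Complex.exp ((W.phase j).φ * Complex.I)) *
      (-(1 / (2 * ((2 * Real.pi * ‖latticeVec (W.phase j).m‖ : ℝ) : ℂ) * Complex.I))) with hA'
  set K : Fin k₀ → (Fin 3 → ℤ) := fun j => fun i => (W.phase j).m i * (n : ℤ) with hK
  set cF : ℝ := ∑ j : Fin k₀, (1 / (n : ℝ)) * (2 * Real.pi * |∑ i, (W.phase j).e i * (ℓ i : ℝ)|) * (‖A j‖ + ‖A' j‖)
    with hcF
  -- the exchange (ladder form) at `ℓ`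
  set S : ℝ → EuclideanSpace ℂ (Fin 3) := fun t => ∑ j : Fin k₀, ((((1 / (n : ℝ)) *
      LatticeWord.trapezoid (W.start j) (W.phase j).τ W.ramp (Int.fract (t / W.period) * W.period) : ℝ) : ℂ) *
      (2 * Real.pi * Complex.I * ∑ i, (EuclideanSpace.complexify (W.phase j).e) i * (ℓ i : ℂ))) •
      Torus.leraySym ℓ (A j • hPV.galerkinCoeffAt N t (ℓ - K j) + A' j • hPV.galerkinCoeffAt N t (ℓ + K j)) with hS
  -- the mode equation at `ℓ` in ladder form, on the window
  have hsub : Icc t₀ t₁ ⊆ Icc 0 T := fun t ht => ⟨ht₀.trans ht.1, ht.2.trans ht₁⟩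
  have hderiv : ∀ t ∈ Icc t₀ t₁, HasDerivWithinAt (fun s => hPV.galerkinCoeffAt N s ℓ)
      (-((L : ℝ) : ℂ) • hPV.galerkinCoeffAt N t ℓ - S t) (Icc t₀ t₁) t := by
    intro t ht
    have hc : ∀ m, m ∉ freqBall N → hPV.galerkinCoeffAt N t m = 0 := fun m hm => by
      rw [Torus.PVSetup.galerkinCoeffAt, coeffExt_of_not_mem _ hm]
    have h := (hPV.hasDerivWithinAt_galerkinCoeffAt hBN hℓN (hsub ht)).mono hsub
    rw [pvGalerkinField_cell W hn κ hBN hc t ℓ] at h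
    refine h.congr_deriv ?_
    rw [hS, hL, neg_smul]
  -- the renormalised vector `f(t) = e^{L(t−t₀)} α(t)(ℓ)`
  set f : ℝ → EuclideanSpace ℂ (Fin 3) := fun t => ((Real.exp (L * (t - t₀)) : ℝ) : ℂ) • hPV.galerkinCoeffAt N t ℓ with hf
  set f' : ℝ → EuclideanSpace ℂ (Fin 3) := fun t => -(((Real.exp (L * (t - t₀)) : ℝ) : ℂ) • S t) with hf'
  have hfd : ∀ t ∈ Icc t₀ t₁, HasDerivWithinAt f (f' t) (Icc t₀ t₁) t := by
    intro t ht
    have he : HasDerivWithinAt (fun s => ((Real.exp (L * (s - t₀)) : ℝ) : ℂ))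
        (((Real.exp (L * (t - t₀)) * L : ℝ) : ℂ)) (Icc t₀ t₁) t := by
      have h1 : HasDerivWithinAt (fun s => L * (s - t₀)) L (Icc t₀ t₁) t := by
        simpa using ((hasDerivWithinAt_id t (Icc t₀ t₁)).sub_const t₀).const_mul L
      exact (h1.exp).ofReal_comp
    have h := he.smul (hderiv t ht)
    refine h.congr_deriv ?_
    simp only [hf', smul_sub, smul_smul]
    rw [show ((Real.exp (L * (t - t₀)) : ℝ) : ℂ) * -((L : ℝ) : ℂ) = -(((Real.exp (L * (t - t₀)) * L : ℝ) : ℂ)) by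
      push_cast; ring, neg_smul]
    abel
  -- the rest modes are bounded by `√R_max`
  have hrest : ∀ t ∈ Icc t₀ t₁, ∀ k' ∈ freqBall N \ {ℓ, -ℓ}, ‖hPV.galerkinCoeffAt N t k'‖ ≤ Real.sqrt Rmax := by
    intro t ht k' hk'
    have h1 : ‖hPV.galerkinCoeffAt N t k'‖ ^ 2 ≤ Rmax :=
      le_trans (Finset.single_le_sum (f := fun k => ‖hPV.galerkinCoeffAt N t k‖ ^ 2) (fun k _ => sq_nonneg _) hk')
        (hR t ht)
    exact Real.le_sqrt_of_sq_le h1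
  have hmodes : ∀ j : Fin k₀, ℓ - K j ∈ freqBall N \ {ℓ, -ℓ} ∧ ℓ + K j ∈ freqBall N \ {ℓ, -ℓ} := by
    intro j
    obtain ⟨-, -, m1, m2, -, -⟩ := fourModes_facts (W.phase j) hn hℓ hℓn
    have hb := hball j ℓ (by simp)
    exact ⟨Finset.mem_sdiff.2 ⟨hb.1, m1⟩, Finset.mem_sdiff.2 ⟨hb.2, m2⟩⟩
  -- the bound on `S`
  have hSle : ∀ t ∈ Icc t₀ t₁, ‖S t‖ ≤ cF * Real.sqrt Rmax := by
    intro t ht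
    rw [hS, hcF, Finset.sum_mul]
    refine (norm_sum_le _ _).trans (Finset.sum_le_sum fun j _ => ?_)
    rw [norm_smul]
    have htrap0 := trapezoid_nonneg (W.start j) (W.phase j).τ W.ramp (Int.fract (t / W.period) * W.period)
    have htrap1 := trapezoid_le_one (W.start j) (W.phase j).τ W.ramp (Int.fract (t / W.period) * W.period)
    have hsumE : (∑ i, (EuclideanSpace.complexify (W.phase j).e) i * (ℓ i : ℂ)) =
        ((∑ i, (W.phase j).e i * (ℓ i : ℝ) : ℝ) : ℂ) := by
      push_cast
      refine Finset.sum_congr rfl fun i _ => ?_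
      rw [EuclideanSpace.complexify_apply]
    have hC : ‖((((1 / (n : ℝ)) * LatticeWord.trapezoid (W.start j) (W.phase j).τ W.ramp
        (Int.fract (t / W.period) * W.period) : ℝ) : ℂ) *
        (2 * Real.pi * Complex.I * ∑ i, (EuclideanSpace.complexify (W.phase j).e) i * (ℓ i : ℂ)))‖ ≤
        (1 / (n : ℝ)) * (2 * Real.pi * |∑ i, (W.phase j).e i * (ℓ i : ℝ)|) := by
      have eC : ((((1 / (n : ℝ)) * LatticeWord.trapezoid (W.start j) (W.phase j).τ W.ramp
          (Int.fract (t / W.period) * W.period) : ℝ) : ℂ) *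
          (2 * Real.pi * Complex.I * ∑ i, (EuclideanSpace.complexify (W.phase j).e) i * (ℓ i : ℂ))) =
          (((1 / (n : ℝ)) * LatticeWord.trapezoid (W.start j) (W.phase j).τ W.ramp
            (Int.fract (t / W.period) * W.period) * (2 * Real.pi * ∑ i, (W.phase j).e i * (ℓ i : ℝ)) : ℝ) : ℂ) *
            Complex.I := by
        rw [hsumE]; push_cast; ring
      have h1n : 0 ≤ 1 / (n : ℝ) * LatticeWord.trapezoid (W.start j) (W.phase j).τ W.ramp
          (Int.fract (t / W.period) * W.period) := by positivity
      rw [eC, norm_mul, Complex.norm_I, mul_one, Complex.norm_real, Real.norm_eq_abs, abs_mul, abs_of_nonneg h1n,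
        abs_mul, abs_mul, abs_two, abs_of_pos Real.pi_pos]
      have h0 : 0 ≤ 2 * Real.pi * |∑ i, (W.phase j).e i * (ℓ i : ℝ)| := by positivity
      have : 1 / (n : ℝ) * LatticeWord.trapezoid (W.start j) (W.phase j).τ W.ramp (Int.fract (t / W.period) * W.period) ≤
          1 / (n : ℝ) * 1 := mul_le_mul_of_nonneg_left htrap1 (by positivity)
      nlinarith
    have hP : ‖Torus.leraySym ℓ (A j • hPV.galerkinCoeffAt N t (ℓ - K j) + A' j • hPV.galerkinCoeffAt N t (ℓ + K j))‖ ≤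
        (‖A j‖ + ‖A' j‖) * Real.sqrt Rmax := by
      refine (Torus.norm_leraySym_le _ _).trans ((norm_add_le _ _).trans ?_)
      rw [norm_smul, norm_smul, add_mul]
      exact add_le_add (mul_le_mul_of_nonneg_left (hrest t ht _ (hmodes j).1) (norm_nonneg _))
        (mul_le_mul_of_nonneg_left (hrest t ht _ (hmodes j).2) (norm_nonneg _))
    calc ‖((((1 / (n : ℝ)) * LatticeWord.trapezoid (W.start j) (W.phase j).τ W.ramp
          (Int.fract (t / W.period) * W.period) : ℝ) : ℂ) *
          (2 * Real.pi * Complex.I * ∑ i, (EuclideanSpace.complexify (W.phase j).e) i * (ℓ i : ℂ)))‖ *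
          ‖Torus.leraySym ℓ (A j • hPV.galerkinCoeffAt N t (ℓ - K j) + A' j • hPV.galerkinCoeffAt N t (ℓ + K j))‖
        ≤ (1 / (n : ℝ)) * (2 * Real.pi * |∑ i, (W.phase j).e i * (ℓ i : ℝ)|) * ((‖A j‖ + ‖A' j‖) * Real.sqrt Rmax) :=
          mul_le_mul hC hP (norm_nonneg _) (by positivity)
      _ = (1 / (n : ℝ)) * (2 * Real.pi * |∑ i, (W.phase j).e i * (ℓ i : ℝ)|) * (‖A j‖ + ‖A' j‖) * Real.sqrt Rmax := by
          ring
  -- the bound on `f'`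
  have hbound : ∀ t ∈ Icc t₀ t₁, ‖f' t‖ ≤ Real.exp (L * (t₁ - t₀)) * (cF * Real.sqrt Rmax) := by
    intro t ht
    rw [hf']
    simp only
    rw [norm_neg, norm_smul, Complex.norm_real, Real.norm_eq_abs, abs_of_pos (Real.exp_pos _)]
    have hexp : Real.exp (L * (t - t₀)) ≤ Real.exp (L * (t₁ - t₀)) :=
      Real.exp_le_exp.2 (mul_le_mul_of_nonneg_left (by linarith [ht.2]) hL0)
    exact mul_le_mul hexp (hSle t ht) (norm_nonneg _) (Real.exp_pos _).le
  intro t ht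
  have ht₀' : t₀ ∈ Icc t₀ t₁ := ⟨le_rfl, ht₀₁⟩
  have h := Convex.norm_image_sub_le_of_norm_hasDerivWithin_le hfd hbound (convex_Icc t₀ t₁) ht₀' ht
  have hf0 : f t₀ = hPV.galerkinCoeffAt N t₀ ℓ := by simp [hf]
  rw [hf0] at h
  simp only [hf] at h
  rw [Real.norm_eq_abs, abs_of_nonneg (by linarith [ht.1])] at h
  rw [hL] at h
  exact h

end Summit.AnomalousDissipation.AnomalousDissipation.Theorems.QuasiStaticSolenoidalCellTensorQ.Negative

end
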